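import Summits.Ventures.HSemireg.WedgeHankelRecurrenceGaussSchurDiscriminant

/-!
# Venture HSemireg — **HILBERT'S DISCRIMINANT OF THE HERMITE POLYNOMIALS AND THE APPELL FAMILIES**: for a recurrence with CONSTANT diagonal `a_n = α` and LINEAR couplings
# `b_{n+1} = (n+1) β` (any commutative ring) the family is APPELL, **`q_{n+1}′ = (n+1) q_n`**, hence (N404) **`disc(q_{n+1}) = β^{n(n+1)∕2} ∏_{k=1}^{n+1} k^k`**; in particular
# **`disc(He_n) = ∏_{k=1}^{n} k^k`** for Mathlib's (probabilists') `Polynomial.hermite n ∈ ℤ[X]` (Hilbert 1888), the same over `ℝ`, **STIELTJES' evaluation `∏_{i<j} (x_j − x_i)² = ∏_{k=1}^{t+1} k^k`**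
# at the zeros of `He_{t+1}`, and `disc = 2^{−n(n+1)∕2} ∏ k^k` for the monic physicists' normalisation `b_{n+1} = (n+1)∕2` of N395

HONEST FRAMING. Part of the Lean index of the computation cell `pub-hsemireg` (seat p10 gen 47, Sunday typer «UNIFORM-IN-n»).  Polynomial algebra (Mathlib `Polynomial.discr`, `Polynomial.resultant`,
`Polynomial.hermite`) only; no variety, no cohomology theory, no sheaf, no Ext group and no semiregularity map is constructed here; nothing here says that HC / HC_CM / HC_AV holds; no Literature
fact (unproved `Prop`) is declared or used.  Custodian versions as in `WedgeHankelSiegelIdeal` (1/3).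
SOURCES (cited).  D. Hilbert, *Über die Discriminante der im Endlichen abbrechenden hypergeometrischen Reihe*, J. reine angew. Math. 103 (1888) 337–345 (the Hermite ∕ Laguerre ∕ Jacobi discriminants);
T. J. Stieltjes, C. R. Acad. Sci. Paris 100 (1885) 439–440 (the same numbers as the extremal values of `∏ |x_i − x_j|`); G. Szegő, *Orthogonal Polynomials*, Thm 6.71, eq. (6.71.7)
(`D(H_n) = 2^{3n(n−1)∕2} ∏ ν^ν`; monic ∕ probabilists' rescaling `∏ ν^ν`); P. Appell, *Sur une classe de polynômes*, Ann. Sci. ÉNS 9 (1880) 119–144 (`P_n′ = n P_{n−1}`); I. Schur, J. reine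
angew. Math. 165 (1931) 52–58, §2.
PROOF TYPED HERE.  The Appell property by a two-step induction on the recurrence (`b_{n+2}(n+1) = (n+2) b_{n+1}` is where linearity of the couplings enters); the discriminant is N404
`discr_recurrence_of_derivative_eq` with `c = n + 1`; `∏_{k<n} ((k+1)β)^{k+1} = β^{n(n+1)∕2} ∏ (k+1)^{k+1}`; the `ℤ → ℝ` transfer is a general `discr (f.map φ) = φ (disc f)` for injective `φ` into a
domain (via `resultant_map_map`, `derivative_map`, `resultant_deriv`); the zero form is N653-block `discr_prod_X_sub_C`.
DEDUP DISCLOSURE (`rg -n -i 'appell|hermite_discr|discr_map|discr_hermite' Summits/Ventures/HSemireg Literature .lake/packages/mathlib/Mathlib/RingTheory/Polynomial`, 2026-09-04): Mathlib has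
`discr_C ∕ discr_of_degree_eq_one ∕ two ∕ three` and `resultant_deriv` only; N359 `hermite_derivative_succ` (`He_{n+1}′ = (n+1) He_n`, reused), N395 `hermitePhys_eq_scaled_hermite`; 0 hits for the 8 names below.

WHAT IS IN THE TREE.  N404 `discr_recurrence_of_derivative_eq`; N359 `hermite_three_term`, `hermite_derivative_succ`, `hermite_zeros`; N653-block `discr_prod_X_sub_C`; Mathlib `Polynomial.hermite_zero ∕ one`,
`resultant_map_map`, `derivative_map`, `resultant_deriv`, `natDegree_map_eq_of_injective`, `leadingCoeff_map_of_injective`, `RingHom.injective_int`.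
THIS FILE (namespace `Summit.Ventures.HSemireg.Wedge.HankelOuter` continued; CHAINED on N404; 0 definitions):
* §1170 **`appell_derivative`** (`a ≡ α`, `b_{n+1} = (n+1)β` ⇒ `q_{n+1}′ = (n+1) q_n`, any commutative ring), `prod_succ_mul_pow_succ` (`∏_{k<n} ((k+1)β)^{k+1} = β^{n(n+1)∕2} ∏_{k<n} (k+1)^{k+1}`),
  **`discr_appell`** (`disc q_{n+1} = β^{n(n+1)∕2} ∏_{k ≤ n} (k+1)^{k+1}`), `discr_map_of_injective` (`disc (f.map φ) = φ (disc f)`), **`hermite_discr`** (`disc He_n = ∏_{k<n} (k+1)^{k+1}` in `ℤ`),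
  `hermite_discr_real`, **`hermite_zeros_discr`** (`(∏_{i<j} (x_j − x_i))² = ∏ (k+1)^{k+1}` whenever `He_{t+1} = ∏ (X − x_k)` over `ℝ`), `hermitePhys_discr` (N395's `b_{n+1} = (n+1)∕2`).
CAVEATS.  `Polynomial.hermite` is the probabilists' `He_n` (monic, `b_n = n`); the physicists' `H_n = 2^{n∕2} He_n(√2 x)` is not monic and is only treated through N395's monic rescaling.
Nothing Ext-side.  New names only.
-/

open Module Polynomial
open scoped Matrix Polynomial

namespace Summit.Ventures.HSemireg.Wedge.HankelOuter

/-! ## §1170. Appell families and Hilbert's Hermite discriminant -/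

/-- **APPELL PROPERTY: constant diagonal `a_n = α` and linear couplings `b_{n+1} = (n+1) β` ⇒ `q_{n+1}′ = (n + 1) · q_n`** (any commutative ring). [Appell 1880; Szegő (5.5.10) (Hermite);
this file, §1170] -/
theorem appell_derivative {R : Type*} [CommRing R] {q : ℕ → R[X]} {a b : ℕ → R} {α β : R} (hq0 : q 0 = 1) (hq1 : q 1 = Polynomial.X - C (a 0))
    (hrec : ∀ n, q (n + 2) = (Polynomial.X - C (a (n + 1))) * q (n + 1) - C (b (n + 1)) * q n) (ha : ∀ n, a n = α) (hb : ∀ n, b (n + 1) = ((n : R) + 1) * β)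
    (n : ℕ) : derivative (q (n + 1)) = C ((n : R) + 1) * q n := by
  have key : ∀ n, derivative (q (n + 1)) = C ((n : R) + 1) * q n ∧ derivative (q (n + 2)) = C ((n : R) + 2) * q (n + 1) := by
    intro n
    induction n with
    | zero =>
      constructor
      · rw [zero_add, hq1, hq0, derivative_sub, derivative_X, derivative_C, sub_zero, Nat.cast_zero, zero_add, map_one, one_mul]
      · rw [hrec 0, hb 0, zero_add, hq1, hq0, ha, ha]
        simp only [derivative_sub, derivative_mul, derivative_X, derivative_C, sub_zero, one_mul, mul_one, Nat.cast_zero, zero_add, map_ofNat]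
        ring
    | succ n ih =>
      obtain ⟨ih1, ih2⟩ := ih
      constructor
      · rw [show n + 1 + 1 = n + 2 from rfl, ih2, Nat.cast_succ, add_assoc, one_add_one_eq_two]
      · rw [hrec (n + 1), hb (n + 1), ha (n + 1 + 1), show n + 1 + 1 = n + 2 from rfl]
        simp only [derivative_sub, derivative_mul, derivative_X, derivative_C, sub_zero, one_mul, zero_mul, zero_add]
        rw [ih1, ih2, hrec n, hb n, ha (n + 1)]
        simp only [map_add, map_mul, map_one, map_natCast, map_ofNat, Nat.cast_add, Nat.cast_one]
        ring
  exact (key n).1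

/-- `∏_{k<n} ((k+1)β)^{k+1} = β^{n(n+1)∕2} · ∏_{k<n} (k+1)^{k+1}`. [bookkeeping; this file, §1170] -/
theorem prod_succ_mul_pow_succ {R : Type*} [CommRing R] (β : R) (n : ℕ) :
    ∏ k ∈ Finset.range n, (((k : R) + 1) * β) ^ (k + 1) = β ^ (n * (n + 1) / 2) * ∏ k ∈ Finset.range n, ((k : R) + 1) ^ (k + 1) := by
  induction n with
  | zero => simp
  | succ n ih =>
    have h2 : (n + 1) * (n + 1 + 1) = n * (n + 1) + 2 * (n + 1) := by ring
    rw [Finset.prod_range_succ, Finset.prod_range_succ, ih, mul_pow, show (n + 1) * (n + 1 + 1) / 2 = n * (n + 1) / 2 + (n + 1) by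
      obtain ⟨c, hc⟩ := Nat.even_mul_succ_self n; omega, pow_add]
    ring

/-- **DISCRIMINANT OF AN APPELL FAMILY: `a ≡ α`, `b_{n+1} = (n+1)β` ⇒ `disc(q_{n+1}) = β^{n(n+1)∕2} ∏_{k ≤ n} (k+1)^{k+1}`** (nontrivial commutative ring). [Hilbert 1888; Schur 1931 §2; Szegő
(6.71.7); this file, §1170] -/
theorem discr_appell {R : Type*} [CommRing R] [Nontrivial R] {q : ℕ → R[X]} {a b : ℕ → R} {α β : R} (hq0 : q 0 = 1) (hq1 : q 1 = Polynomial.X - C (a 0))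
    (hrec : ∀ n, q (n + 2) = (Polynomial.X - C (a (n + 1))) * q (n + 1) - C (b (n + 1)) * q n) (ha : ∀ n, a n = α) (hb : ∀ n, b (n + 1) = ((n : R) + 1) * β)
    (n : ℕ) : (q (n + 1)).discr = β ^ (n * (n + 1) / 2) * ∏ k ∈ Finset.range (n + 1), ((k : R) + 1) ^ (k + 1) := by
  rw [discr_recurrence_of_derivative_eq hq0 hq1 hrec (appell_derivative hq0 hq1 hrec ha hb n), Finset.prod_congr rfl fun k _ => by rw [hb k],
    prod_succ_mul_pow_succ, Finset.prod_range_succ _ n]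
  ring

/-- **`disc (f.map φ) = φ (disc f)` for an injective ring map into a domain** (via `Res(f, f′)`; Mathlib has `resultant_map_map` but no `discr_map`). [this file, §1170] -/
theorem discr_map_of_injective {R S : Type*} [CommRing R] [CommRing S] [IsDomain S] {φ : R →+* S} (hφ : Function.Injective φ) (f : R[X]) :
    (f.map φ).discr = φ f.discr := by
  rcases Nat.eq_zero_or_pos f.natDegree with h0 | hpos
  · obtain ⟨r, hr⟩ := natDegree_eq_zero.mp h0
    rw [← hr, Polynomial.map_C, discr_C, discr_C, map_one]
  · have hdeg : (f.map φ).natDegree = f.natDegree := natDegree_map_eq_of_injective hφ f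
    have hlc : (f.map φ).leadingCoeff = φ f.leadingCoeff := leadingCoeff_map_of_injective hφ f
    have h1 := resultant_deriv (f := f) (natDegree_pos_iff_degree_pos.mp hpos)
    have h2 := resultant_deriv (f := f.map φ) (natDegree_pos_iff_degree_pos.mp (by rw [hdeg]; exact hpos))
    rw [hdeg, hlc, derivative_map, resultant_map_map, h1, map_mul, map_mul, map_pow, map_neg, map_one] at h2
    have hlc0 : f.leadingCoeff ≠ 0 := fun h => by rw [leadingCoeff_eq_zero] at h; rw [h, natDegree_zero] at hpos; exact lt_irrefl 0 hpos
    have hne : (-1 : S) ^ (f.natDegree * (f.natDegree - 1) / 2) * φ f.leadingCoeff ≠ 0 :=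
      mul_ne_zero (pow_ne_zero _ (neg_ne_zero.mpr one_ne_zero)) ((map_ne_zero_iff φ hφ).mpr hlc0)
    exact (mul_left_cancel₀ hne h2).symm

/-- **HILBERT (1888): `disc(He_n) = ∏_{k=1}^{n} k^k`** for Mathlib's probabilists' Hermite polynomial `Polynomial.hermite n ∈ ℤ[X]`. [Hilbert 1888; Szegő (6.71.7); this file, §1170] -/
theorem hermite_discr (n : ℕ) : (Polynomial.hermite n).discr = ∏ k ∈ Finset.range n, ((k : ℤ) + 1) ^ (k + 1) := by
  rcases n with _ | n
  · rw [Polynomial.hermite_zero, discr_C, Finset.prod_range_zero]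
  · have h := discr_appell (R := ℤ) (q := fun m => Polynomial.hermite m) (a := fun _ => 0) (b := fun k => (k : ℤ)) (α := 0) (β := 1)
      (by simp only [Polynomial.hermite_zero, map_one]) (by simp only [Polynomial.hermite_one, C_0, sub_zero])
      (fun m => by simp only [hermite_three_term, C_0, sub_zero]; push_cast; rfl) (fun _ => rfl) (fun m => by push_cast; ring) n
    simp only [one_pow, one_mul] at h
    exact h

/-- `disc(He_n) = ∏ k^k` read in `ℝ`. [Hilbert 1888; this file, §1170] -/
theorem hermite_discr_real (n : ℕ) : ((Polynomial.hermite n).map (Int.castRingHom ℝ)).discr = ∏ k ∈ Finset.range n, ((k : ℝ) + 1) ^ (k + 1) := by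
  rw [discr_map_of_injective (Int.castRingHom ℝ).injective_int, hermite_discr]
  simp

/-- **STIELTJES' VALUE OF THE HERMITE VANDERMONDE: `(∏_{i<j} (x_j − x_i))² = ∏_{k=1}^{t+1} k^k`** whenever `He_{t+1} = ∏_k (X − x_k)` over `ℝ` (in particular at the ordered zeros of N359
`hermite_zeros`). [Stieltjes 1885; Szegő Thm 6.7.2 ∕ (6.71.7); this file, §1170] -/
theorem hermite_zeros_discr {t : ℕ} {x : Fin (t + 1) → ℝ} (hxq : (Polynomial.hermite (t + 1)).map (Int.castRingHom ℝ) = ∏ k, (Polynomial.X - C (x k))) :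
    (∏ i : Fin (t + 1), ∏ j ∈ Finset.Ioi i, (x j - x i)) ^ 2 = ∏ k ∈ Finset.range (t + 1), ((k : ℝ) + 1) ^ (k + 1) := by
  rw [← discr_prod_X_sub_C ℝ x, ← hxq, hermite_discr_real]

/-- **The monic physicists' normalisation (`a ≡ 0`, `b_{n+1} = (n+1)∕2`, N395): `disc(q_{n+1}) = (1∕2)^{n(n+1)∕2} ∏_{k ≤ n} (k+1)^{k+1}`** (`= 2^{−2n(n+1)} · D(H_{n+1})` with Szegő's
`D(H_N) = 2^{3N(N−1)∕2} ∏ ν^ν`). [Szegő (6.71.7); this file, §1170] -/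
theorem hermitePhys_discr {q : ℕ → ℝ[X]} {a b : ℕ → ℝ} (hq0 : q 0 = 1) (hq1 : q 1 = Polynomial.X - C (a 0))
    (hrec : ∀ n, q (n + 2) = (Polynomial.X - C (a (n + 1))) * q (n + 1) - C (b (n + 1)) * q n) (ha : ∀ n, a n = 0) (hb : ∀ n, b (n + 1) = ((n : ℝ) + 1) / 2) (n : ℕ) :
    (q (n + 1)).discr = (1 / 2 : ℝ) ^ (n * (n + 1) / 2) * ∏ k ∈ Finset.range (n + 1), ((k : ℝ) + 1) ^ (k + 1) :=
  discr_appell hq0 hq1 hrec ha (fun m => by rw [hb m]; ring) n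

end Summit.Ventures.HSemireg.Wedge.HankelOuter
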